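import Summits.Langlands.Langlands.Theses.SkinnerWilesDefectOne

/-!
# Route SkinnerWilesDefectOne — `SectorComplement` (stmt-Langlands-12923): logical position

`SectorComplement := ReducibleOrdinaryModular → Langlands` is the route's declared COMPLEMENT OF THE
SECTOR (D-0027 §2.1 convention): the third hypothesis of the deciding theorem
`Theses.SkinnerWilesDefectOne.closes : ReducibleOrdinaryProModular → ProModularOrdinaryClassical →
SectorComplement → Langlands`, filed only so that `closes` ends in the summit constant by name, and
declared "not attacked, not expected to close before the summit".

This file does NOT assert the item (nor its negation). It records, kernel-checked, exactly where the
item sits, so that its status `open-problem` is a theorem-shaped fact rather than a remark: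

* `skinnerWilesDefectOne_sectorComplement_of_langlands`: `Langlands → SectorComplement`;
* `skinnerWilesDefectOne_sectorComplement_iff_of_target`: under the route target
  `ReducibleOrdinaryModular`, `SectorComplement ↔ Langlands`;
* `skinnerWilesDefectOne_sectorComplement_iff_of_cruxes`: under the engine
  `ReducibleOrdinaryProModular` and the exit `ProModularOrdinaryClassical` (the other two hypotheses
  of `closes`), `SectorComplement ↔ Langlands` — so once the route's own cruxes land, this item IS
  the summit;
* `skinnerWilesDefectOne_not_sectorComplement_iff`: `¬ SectorComplement ↔ ReducibleOrdinaryModular ∧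
  ¬ Langlands` — a refutation must PROVE the (open) sector theorem (Skinner–Wiles Theorem A over an
  imaginary quadratic field) AND disprove the formal summit;
* `skinnerWilesDefectOne_sectorComplement_iff_not_or`: truth table
  `SectorComplement ↔ ¬ ReducibleOrdinaryModular ∨ Langlands`;
* `skinnerWilesDefectOne_sectorComplement_localLanglandsDebt`: frame + target give a local Langlands
  datum for `GL_n(F_v)` at every finite place of every number field (Harris–Taylor debt of `𝓡`).

The converse bookkeeping identity `Langlands ↔ ReducibleOrdinaryModular ∧ SectorComplement` is NOT
derivable in the tree: `Langlands → ReducibleOrdinaryModular` would need "oriented ordinary of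
weight `k ≥ 2` ⇒ de Rham" relative to the reciprocity data `𝓡` that `Langlands` only asserts to
exist (`IsGeometricFramed 𝓡 ρ` reads the abstract `PstWeilDeligneData`, whose fields give de Rham
only for locally unramified `ρ`), so it is deliberately absent.
-/

set_option linter.dupNamespace false -- project-wide option; `Summit.Langlands.Langlands` is the mandated namespace

namespace Summit.Langlands.Langlands.Theorems

open Summit.Langlands.Langlands.Theses.SkinnerWilesDefectOne

/-- The frame is implied by the summit: `Langlands → SectorComplement` (discard the sector
hypothesis). [folklore] -/
theorem skinnerWilesDefectOne_sectorComplement_of_langlands :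
    _root_.Langlands → SectorComplement :=
  fun h _ ↦ h

/-- Under the route TARGET `ReducibleOrdinaryModular` (Skinner–Wiles Theorem A at defect one), the
frame is literally the summit: `SectorComplement ↔ Langlands`. [folklore] -/
theorem skinnerWilesDefectOne_sectorComplement_iff_of_target (hX : ReducibleOrdinaryModular) :
    SectorComplement ↔ _root_.Langlands :=
  ⟨fun hC ↦ hC hX, fun h _ ↦ h⟩

/-- Under the other two hypotheses of the deciding theorem — the engine `ReducibleOrdinaryProModular`
and the exit `ProModularOrdinaryClassical` — the frame is equivalent to the summit:
`SectorComplement ↔ Langlands` (`→` is the route's sorry-free `closes`). So this item can close only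
together with the summit once the route's cruxes land. [folklore] -/
theorem skinnerWilesDefectOne_sectorComplement_iff_of_cruxes (h₁ : ReducibleOrdinaryProModular)
    (h₂ : ProModularOrdinaryClassical) : SectorComplement ↔ _root_.Langlands :=
  ⟨fun hC ↦ closes h₁ h₂ hC, fun h _ ↦ h⟩

/-- The exact content of a refutation of the frame:
`¬ SectorComplement ↔ ReducibleOrdinaryModular ∧ ¬ Langlands` — prove the open sector theorem AND
disprove the formal summit. [folklore] -/
theorem skinnerWilesDefectOne_not_sectorComplement_iff :
    ¬ SectorComplement ↔ ReducibleOrdinaryModular ∧ ¬ _root_.Langlands :=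
  Classical.not_imp

/-- Any refutation of the frame is a disproof of the formal summit `_root_.Langlands`. [folklore] -/
theorem skinnerWilesDefectOne_not_langlands_of_not_sectorComplement :
    ¬ SectorComplement → ¬ _root_.Langlands :=
  fun h ↦ (skinnerWilesDefectOne_not_sectorComplement_iff.1 h).2

/-- Truth table of the frame: `SectorComplement ↔ ¬ ReducibleOrdinaryModular ∨ Langlands`. It is
PROVABLE only by proving the summit or by refuting the route target (a counterexample to
Fontaine–Mazur in the residually reducible oriented-ordinary sector over an imaginary quadratic
field), and REFUTABLE only in the world "target true, summit false". [folklore] -/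
theorem skinnerWilesDefectOne_sectorComplement_iff_not_or :
    SectorComplement ↔ ¬ ReducibleOrdinaryModular ∨ _root_.Langlands :=
  imp_iff_not_or

/-- The frame carries the summit's shared Statement debt: together with the route target it yields,
for EVERY number field `F` and EVERY finite place `v`, a local Langlands datum for the general linear
groups over `F_v` (the `llc` field of the reciprocity data `𝓡` that `Langlands` asserts to exist) —
Harris–Taylor/Henniart content (named fact `LocalLanglandsDatum.nonempty`), far outside the
`GL₂`/imaginary-quadratic sector. [folklore] -/
theorem skinnerWilesDefectOne_sectorComplement_localLanglandsDebt (hC : SectorComplement)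
    (hX : ReducibleOrdinaryModular) (F : Type) [Field F] [NumberField F]
    (v : IsDedekindDomain.HeightOneSpectrum (NumberField.RingOfIntegers F)) :
    Nonempty (Literature.NumberTheory.Automorphic.LocalLanglandsDatum (v.adicCompletion F)) := by
  -- `Langlands` was re-typed (2026-08-17): `∀ F, Nonempty (ReciprocityData F) ∧ ∀ 𝓡 …` instead of `∀ F, ∃ 𝓡, …`
  obtain ⟨⟨𝓡⟩, -⟩ := hC hX F
  exact ⟨𝓡.llc v⟩

end Summit.Langlands.Langlands.Theorems
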